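import Mathlib

/-!
# Route `UnthreadedDoor`, crux `PoloidalLiouville` (stmt-NavierStokesRegularity-1222), wall W1 — crux idea
# «flux-starved-dipoles» (ns-idea-15 g12/g13, `Cruxes/PoloidalLiouville/FluxStarvedDipoleSketch.lean`):
# the CONVEX ENDGAME of K1 `DipoleNeverSteady`, kernel-checked

The typed sketch composes K1 (`DipoleNeverSteady`: no steady toroidal dipole `B = A(r) × ξ` is maintained on `ℝ³` by any
`C¹` incompressible drift) as `dipoleNeverSteady_of : AmplitudeLawSteady → ConvexEndgame → DipoleNeverSteady`, with both
antecedents PAPER-proved only.  THIS FILE proves the second antecedent, the one-variable real-analysis endgame, with the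
sketch's statement VERBATIM as the theorem type:

`FluxStarvedDipole.convexEndgame`: a continuous `w ≥ 0` on `(0,∞)` with `w ≤ C·r`, which is `C²` with `w″ ≥ 2w/r²` wherever
it is positive, vanishes identically.

PROOF (different bookkeeping from the card's six lines, same content).  Put `E(r) := r²w′(r) − 2r w(r)` and `z := w/r²`, so
`z′ = E/r⁴` and, at every point where `w > 0`, `E′ = r²w″ − 2w ≥ 0`.  (i) PROPAGATION: if `w(a) > 0` and `E(a) ≥ 0` then
`w(r) ≥ z(a)·r²` for all `r ≥ a` (continuous induction on `inf {r ≥ a : w(r) < z(a)r²}`: below it `w > 0`, so `E` is monotone,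
`E ≥ 0`, `z` is monotone; at it the bound holds by continuity, so `w > 0` on a neighbourhood and the bound extends past it) —
incompatible with `w ≤ C·r` at `r > C/z(a)`.  (ii) If `w(r₀) > 0` and `w` has a zero `r₁ ∈ (0,r₀)` (take the largest), `z`
attains its maximum over `[r₁, R]` (`R` large, `z(R) ≤ C/R < z(r₀)`) at an interior point `m`, where `z′(m) = 0`, i.e.
`E(m) = 0`: apply (i) at `m`.  (iii) If `w > 0` on `(0,r₀]` and `E ≥ 0` somewhere there, apply (i); otherwise `E < 0` on
`(0,r₀]`, `E` monotone gives `E ≤ E(r₀) = −δ < 0`, so `(z − δ/(3r³))′ = (E + δ)/r⁴ ≤ 0`, `z(r) ≥ δ/(3r³) + c₀`,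
`w(r) ≥ δ/(3r) + c₀r²` — incompatible with `w ≤ C·r` as `r → 0⁺`.

HONEST LABEL: a reusable real-analysis lemma closing ONE typed Prop (`ConvexEndgame`) of an information-grade crux card in the
LINEAR kinematic shadow of W1 (critic V28: W1 movement 0); `AmplitudeLawSteady`, `FluxStarvationSteady`, K1 itself,
`PoloidalLiouville` (1222), its wall `stub_scalarLiouville` and the summit stay OPEN; NO Navier–Stokes regularity statement is
proved.  `--supports stmt-NavierStokesRegularity-1222` (helper).  [folklore]
-/

noncomputable section

-- the summit and its single sub-problem share the name (CONVENTIONS §1)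
set_option linter.dupNamespace false

open Set Filter Topology

namespace Summit.NavierStokesRegularity.NavierStokesRegularity.Theorems.PoloidalLiouville.FluxStarvedDipole

variable {w : ℝ → ℝ}

/-- At a point where `w` is `C²`, `deriv w` is differentiable with derivative `iteratedDeriv 2 w r`. [folklore] -/
theorem convexEndgame_hasDerivAt_deriv {r : ℝ} (h : ContDiffAt ℝ 2 w r) :
    HasDerivAt (deriv w) (iteratedDeriv 2 w r) r := by
  have h2 : DifferentiableAt ℝ (deriv w) r := by
    have h1 : ContDiffAt ℝ 1 (fderiv ℝ w) r := h.fderiv_right (le_of_eq one_add_one_eq_two)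
    have h1' : DifferentiableAt ℝ (fderiv ℝ w) r := h1.differentiableAt one_ne_zero
    have := h1'.clm_apply (differentiableAt_const (1 : ℝ))
    simpa only [fderiv_apply_one_eq_deriv] using this
  rw [iteratedDeriv_succ, iteratedDeriv_one]
  exact h2.hasDerivAt

/-- The auxiliary quantity `E(r) = r² w′(r) − 2 r w(r)` has derivative `r² w″(r) − 2 w(r)` at a `C²` point. [folklore] -/
theorem convexEndgame_hasDerivAt_E {r : ℝ} (h : ContDiffAt ℝ 2 w r) :
    HasDerivAt (fun x => x ^ 2 * deriv w x - 2 * x * w x)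
      (r ^ 2 * iteratedDeriv 2 w r - 2 * w r) r := by
  have hw : HasDerivAt w (deriv w r) r := (h.differentiableAt (by norm_num)).hasDerivAt
  have hw' : HasDerivAt (deriv w) (iteratedDeriv 2 w r) r := convexEndgame_hasDerivAt_deriv h
  have hsq : HasDerivAt (fun x : ℝ => x ^ 2) (2 * r) r := by
    simpa using hasDerivAt_pow 2 r
  have h2 : HasDerivAt (fun x : ℝ => 2 * x) 2 r := by
    simpa using (hasDerivAt_id r).const_mul (2 : ℝ)
  have h4 := (hsq.fun_mul hw').fun_sub (h2.fun_mul hw)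
  exact h4.congr_deriv (by ring)

/-- `z = w/r²` has derivative `E(r)/r⁴` at a point `r ≠ 0` where `w` is differentiable. [folklore] -/
theorem convexEndgame_hasDerivAt_z {r : ℝ} (hr : r ≠ 0) (h : DifferentiableAt ℝ w r) :
    HasDerivAt (fun x => w x / x ^ 2) ((r ^ 2 * deriv w r - 2 * r * w r) / r ^ 4) r := by
  have hw : HasDerivAt w (deriv w r) r := h.hasDerivAt
  have hsq : HasDerivAt (fun x : ℝ => x ^ 2) (2 * r) r := by
    simpa using hasDerivAt_pow 2 r
  exact (hw.fun_div hsq (pow_ne_zero 2 hr)).congr_deriv (by ring)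

/-- The comparison function `δ/(3r³)` has derivative `−δ/r⁴` at `r ≠ 0`. [folklore] -/
theorem convexEndgame_hasDerivAt_phi (δ : ℝ) {r : ℝ} (hr : r ≠ 0) :
    HasDerivAt (fun x : ℝ => δ / (3 * x ^ 3)) (-(δ / r ^ 4)) r := by
  have h3 : HasDerivAt (fun x : ℝ => 3 * x ^ 3) (3 * (3 * r ^ 2)) r := by
    simpa using (hasDerivAt_pow 3 r).const_mul (3 : ℝ)
  have hne : (3 : ℝ) * r ^ 3 ≠ 0 := mul_ne_zero three_ne_zero (pow_ne_zero 3 hr)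
  refine ((hasDerivAt_const r δ).fun_div h3 hne).congr_deriv ?_
  field_simp
  ring

/-- On a closed interval `[a,b] ⊂ (0,∞)` on which `w > 0` (hence `w` is `C²` with `w″ ≥ 2w/r²`), the quantity
`E(r) = r² w′ − 2 r w` is monotone. [folklore] -/
theorem convexEndgame_monotoneOn_E {a b : ℝ} (ha : 0 < a)
    (h2 : ∀ r > 0, 0 < w r → ContDiffAt ℝ 2 w r ∧ 2 * w r / r ^ 2 ≤ iteratedDeriv 2 w r)
    (hpos : ∀ r ∈ Icc a b, 0 < w r) :
    MonotoneOn (fun x => x ^ 2 * deriv w x - 2 * x * w x) (Icc a b) := by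
  have hd : ∀ r ∈ Icc a b, HasDerivAt (fun x => x ^ 2 * deriv w x - 2 * x * w x)
      (r ^ 2 * iteratedDeriv 2 w r - 2 * w r) r := fun r hr =>
    convexEndgame_hasDerivAt_E (h2 r (ha.trans_le hr.1) (hpos r hr)).1
  apply monotoneOn_of_deriv_nonneg (convex_Icc a b)
  · exact fun r hr => (hd r hr).continuousAt.continuousWithinAt
  · exact fun r hr => (hd r (interior_subset hr)).differentiableAt.differentiableWithinAt
  · intro r hr
    have hr' : r ∈ Icc a b := interior_subset hr
    rw [(hd r hr').deriv]
    have hrpos : 0 < r := ha.trans_le hr'.1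
    have hr0 : r ≠ 0 := hrpos.ne'
    have hineq := (h2 r hrpos (hpos r hr')).2
    have hr2 : 0 < r ^ 2 := by positivity
    have hmul : 2 * w r ≤ r ^ 2 * iteratedDeriv 2 w r := by
      calc 2 * w r = (2 * w r / r ^ 2) * r ^ 2 := by field_simp
        _ ≤ iteratedDeriv 2 w r * r ^ 2 := mul_le_mul_of_nonneg_right hineq hr2.le
        _ = r ^ 2 * iteratedDeriv 2 w r := by ring
    linarith

/-- PROPAGATION STEP.  If `w(a) > 0` and `E(a) = a² w′(a) − 2a w(a) ≥ 0`, then `w(r) ≥ (w(a)/a²)·r²` for every `r ≥ a`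
(continuous induction on the first failure point). [folklore] -/
theorem convexEndgame_sq_growth (hc : ContinuousOn w (Ioi 0))
    (h2 : ∀ r > 0, 0 < w r → ContDiffAt ℝ 2 w r ∧ 2 * w r / r ^ 2 ≤ iteratedDeriv 2 w r)
    {a : ℝ} (ha : 0 < a) (hwa : 0 < w a) (hEa : 0 ≤ a ^ 2 * deriv w a - 2 * a * w a) :
    ∀ r, a ≤ r → w a / a ^ 2 * r ^ 2 ≤ w r := by
  set za := w a / a ^ 2 with hza_def
  have ha0 : a ≠ 0 := ha.ne'
  have hza : 0 < za := div_pos hwa (pow_pos ha 2)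
  by_contra hcon
  push Not at hcon
  obtain ⟨r₁, har₁, hr₁⟩ := hcon
  set B : Set ℝ := {r | a ≤ r ∧ w r < za * r ^ 2} with hB
  have hBne : B.Nonempty := ⟨r₁, har₁, hr₁⟩
  have hBbdd : BddBelow B := ⟨a, fun r hr => hr.1⟩
  set s := sInf B with hs
  have has : a ≤ s := le_csInf hBne fun r hr => hr.1
  have hspos : 0 < s := ha.trans_le has
  -- below `s` (and at or after `a`) the bound holds
  have hbelow : ∀ r, a ≤ r → r < s → za * r ^ 2 ≤ w r := by
    intro r har hrs
    by_contra h
    push Not at h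
    have hrB : r ∈ B := ⟨har, h⟩
    exact absurd (csInf_le hBbdd hrB) (not_le.mpr hrs)
  -- at `s` the bound holds
  have hats : za * s ^ 2 ≤ w s := by
    rcases eq_or_lt_of_le has with h | h
    · rw [← h, hza_def]
      have : w a / a ^ 2 * a ^ 2 = w a := by field_simp
      rw [this]
    · have hcont : ContinuousAt (fun r => w r - za * r ^ 2) s := by
        have hws : ContinuousAt w s := hc.continuousAt (Ioi_mem_nhds hspos)
        exact hws.sub (continuousAt_const.mul (continuousAt_id.pow 2))
      have hev : ∀ᶠ r in 𝓝[<] s, 0 ≤ w r - za * r ^ 2 := by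
        filter_upwards [Ioo_mem_nhdsLT h] with r hr
        have := hbelow r hr.1.le hr.2
        linarith
      have hlim : Tendsto (fun r => w r - za * r ^ 2) (𝓝[<] s) (𝓝 (w s - za * s ^ 2)) :=
        hcont.tendsto.mono_left nhdsWithin_le_nhds
      have := ge_of_tendsto hlim hev
      linarith
  have hws : 0 < w s := lt_of_lt_of_le (by positivity) hats
  -- the positivity set is open: a neighbourhood of `s` on which `w > 0`
  have hPopen : IsOpen (Ioi (0 : ℝ) ∩ w ⁻¹' Ioi 0) := hc.isOpen_inter_preimage isOpen_Ioi isOpen_Ioi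
  have hsP : s ∈ Ioi (0 : ℝ) ∩ w ⁻¹' Ioi 0 := ⟨hspos, hws⟩
  obtain ⟨δ, hδ, hball⟩ := Metric.isOpen_iff.mp hPopen s hsP
  set b := s + δ / 2 with hb
  have hsb : s < b := by rw [hb]; linarith
  have hab : a ≤ b := has.trans hsb.le
  -- `w > 0` on `[a, b]`
  have hposab : ∀ r ∈ Icc a b, 0 < w r := by
    intro r hr
    have hr0 : 0 < r := ha.trans_le hr.1
    rcases lt_or_ge r s with h | h
    · exact lt_of_lt_of_le (by positivity) (hbelow r hr.1 h)
    · have hmem : r ∈ Metric.ball s δ := by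
        rw [Metric.mem_ball, Real.dist_eq, abs_lt]
        constructor <;> linarith [hr.2]
      exact (hball hmem).2
  -- `E ≥ 0` on `[a, b]`
  have hE : ∀ r ∈ Icc a b, 0 ≤ r ^ 2 * deriv w r - 2 * r * w r := by
    intro r hr
    have hmono := convexEndgame_monotoneOn_E ha h2 hposab
    exact hEa.trans (hmono (left_mem_Icc.mpr hab) hr hr.1)
  -- `z = w/r²` is monotone on `[a, b]`
  have hzmono : MonotoneOn (fun x => w x / x ^ 2) (Icc a b) := by
    have hd : ∀ r ∈ Icc a b, HasDerivAt (fun x => w x / x ^ 2)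
        ((r ^ 2 * deriv w r - 2 * r * w r) / r ^ 4) r := by
      intro r hr
      have hr0 : 0 < r := ha.trans_le hr.1
      exact convexEndgame_hasDerivAt_z hr0.ne'
        ((h2 r hr0 (hposab r hr)).1.differentiableAt (by norm_num))
    apply monotoneOn_of_deriv_nonneg (convex_Icc a b)
    · exact fun r hr => (hd r hr).continuousAt.continuousWithinAt
    · exact fun r hr => (hd r (interior_subset hr)).differentiableAt.differentiableWithinAt
    · intro r hr
      have hr' : r ∈ Icc a b := interior_subset hr
      rw [(hd r hr').deriv]
      have hr0 : 0 < r := ha.trans_le hr'.1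
      exact div_nonneg (hE r hr') (by positivity)
  -- hence the bound on `[a, b]`
  have hbound : ∀ r ∈ Icc a b, za * r ^ 2 ≤ w r := by
    intro r hr
    have hr0 : 0 < r := ha.trans_le hr.1
    have hr0' : r ≠ 0 := hr0.ne'
    have hz : za ≤ w r / r ^ 2 := hzmono (left_mem_Icc.mpr hab) hr hr.1
    calc za * r ^ 2 ≤ (w r / r ^ 2) * r ^ 2 := mul_le_mul_of_nonneg_right hz (by positivity)
      _ = w r := by field_simp
  -- contradiction: `b ≤ inf B = s < b`
  have hbs : b ≤ s := by
    apply le_csInf hBne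
    intro r hr
    by_contra h
    push Not at h
    have hrI : r ∈ Icc a b := ⟨hr.1, h.le⟩
    exact absurd (hbound r hrI) (not_le.mpr hr.2)
  linarith

/-- **CONVEX ENDGAME** (`Cruxes/PoloidalLiouville/FluxStarvedDipoleSketch.lean`, Prop `ConvexEndgame`, VERBATIM as the type):
a continuous `w ≥ 0` on `(0,∞)` with `w ≤ C·r` which is `C²` with `w″ ≥ 2w/r²` wherever it is positive vanishes
identically.  Second antecedent of the kernel composition `dipoleNeverSteady_of` (K1 of the crux card «flux-starved-dipoles»);
W1 / `PoloidalLiouville` / NS regularity are NOT touched. [folklore] -/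
theorem convexEndgame :
    ∀ (w : ℝ → ℝ) (C : ℝ), ContinuousOn w (Set.Ioi 0) → (∀ r > 0, 0 ≤ w r) → (∀ r > 0, w r ≤ C * r) →
      (∀ r > 0, 0 < w r → ContDiffAt ℝ 2 w r ∧ 2 * w r / r ^ 2 ≤ iteratedDeriv 2 w r) →
      ∀ r > 0, w r = 0 := by
  intro w C hc h0 hC h2 r₀ hr₀
  by_contra hne
  have hw₀ : 0 < w r₀ := lt_of_le_of_ne (h0 r₀ hr₀) (Ne.symm hne)
  have hCpos : 0 < C := by
    have h := hC r₀ hr₀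
    by_contra hle
    push Not at hle
    nlinarith
  -- the contradiction device: a point `a` with `w a > 0` and `E a ≥ 0` is impossible
  have key : ∀ a, 0 < a → 0 < w a → 0 ≤ a ^ 2 * deriv w a - 2 * a * w a → False := by
    intro a ha hwa hEa
    have hg := convexEndgame_sq_growth hc h2 ha hwa hEa
    set za := w a / a ^ 2 with hza_def
    have hza : 0 < za := div_pos hwa (pow_pos ha 2)
    have hza0 : za ≠ 0 := hza.ne'
    set R := max a (C / za + 1) with hR
    have haR : a ≤ R := le_max_left _ _
    have hRpos : 0 < R := ha.trans_le haR
    have hR2 : C / za + 1 ≤ R := le_max_right _ _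
    have h1 : za * R ^ 2 ≤ w R := hg R haR
    have h2' : w R ≤ C * R := hC R hRpos
    have hlt : C < za * R := by
      have h' : C / za < R := by linarith
      calc C = C / za * za := by field_simp
        _ < R * za := mul_lt_mul_of_pos_right h' hza
        _ = za * R := mul_comm _ _
    nlinarith [mul_lt_mul_of_pos_right hlt hRpos]
  by_cases hz : ∃ s, 0 < s ∧ s < r₀ ∧ w s = 0
  · -- Case A: there is a zero below `r₀`; let `r₁` be the largest one
    obtain ⟨s, hs0, hsr, hws⟩ := hz
    set Z : Set ℝ := Icc s r₀ ∩ w ⁻¹' {0} with hZ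
    have hZclosed : IsClosed Z := by
      have hcI : ContinuousOn w (Icc s r₀) := hc.mono fun x hx => hs0.trans_le hx.1
      exact hcI.preimage_isClosed_of_isClosed isClosed_Icc isClosed_singleton
    have hZne : Z.Nonempty := ⟨s, left_mem_Icc.mpr hsr.le, hws⟩
    have hZbdd : BddAbove Z := ⟨r₀, fun x hx => hx.1.2⟩
    set r₁ := sSup Z with hr₁
    have hr₁Z : r₁ ∈ Z := hZclosed.csSup_mem hZne hZbdd
    have hr₁pos : 0 < r₁ := hs0.trans_le hr₁Z.1.1
    have hwr₁ : w r₁ = 0 := hr₁Z.2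
    have hr₁le : r₁ ≤ r₀ := hr₁Z.1.2
    have hr₁lt : r₁ < r₀ := lt_of_le_of_ne hr₁le fun h => hne (h ▸ hwr₁)
    -- choose `R` with `C/R < z₀ := w r₀ / r₀²`
    set z₀ := w r₀ / r₀ ^ 2 with hz₀
    have hz₀pos : 0 < z₀ := div_pos hw₀ (pow_pos hr₀ 2)
    have hz₀ne : z₀ ≠ 0 := hz₀pos.ne'
    set R := r₀ + C / z₀ + 1 with hRdef
    have hr₀R : r₀ < R := by
      have : 0 < C / z₀ := div_pos hCpos hz₀pos
      linarith
    have hRpos : 0 < R := hr₀.trans hr₀R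
    have hCR : C / R < z₀ := by
      rw [div_lt_iff₀ hRpos]
      have h' : C / z₀ < R := by linarith
      calc C = C / z₀ * z₀ := by field_simp
        _ < R * z₀ := mul_lt_mul_of_pos_right h' hz₀pos
        _ = z₀ * R := mul_comm _ _
    -- `z` attains its maximum on `[r₁, R]` at an interior point
    have hcz : ContinuousOn (fun x => w x / x ^ 2) (Icc r₁ R) := by
      have hcI : ContinuousOn w (Icc r₁ R) := hc.mono fun x hx => hr₁pos.trans_le hx.1
      exact hcI.div ((continuous_pow 2).continuousOn)
        fun x hx => pow_ne_zero 2 (hr₁pos.trans_le hx.1).ne'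
    obtain ⟨m, hmI, hmax⟩ := (isCompact_Icc : IsCompact (Icc r₁ R)).exists_isMaxOn
      (nonempty_Icc.mpr (hr₁lt.le.trans hr₀R.le)) hcz
    have hr₀I : r₀ ∈ Icc r₁ R := ⟨hr₁le, hr₀R.le⟩
    have hzm : z₀ ≤ w m / m ^ 2 := isMaxOn_iff.mp hmax r₀ hr₀I
    have hm0 : 0 < m := hr₁pos.trans_le hmI.1
    have hwm : 0 < w m := by
      by_contra hle
      push Not at hle
      have : w m / m ^ 2 ≤ 0 := div_nonpos_iff.mpr (Or.inr ⟨hle, by positivity⟩)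
      linarith
    have hm1 : m ≠ r₁ := fun h => by
      rw [h, hwr₁] at hwm
      exact lt_irrefl 0 hwm
    have hm2 : m ≠ R := by
      intro h
      have hle : w R / R ^ 2 ≤ C / R := by
        rw [div_le_div_iff₀ (pow_pos hRpos 2) hRpos]
        nlinarith [hC R hRpos]
      rw [h] at hzm
      linarith
    have hmIoo : m ∈ Ioo r₁ R := ⟨lt_of_le_of_ne hmI.1 (Ne.symm hm1), lt_of_le_of_ne hmI.2 hm2⟩
    have hlocmax : IsLocalMax (fun x => w x / x ^ 2) m := hmax.isLocalMax (Icc_mem_nhds hmIoo.1 hmIoo.2)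
    have hdz := convexEndgame_hasDerivAt_z hm0.ne' ((h2 m hm0 hwm).1.differentiableAt (by norm_num))
    have hderiv0 : (m ^ 2 * deriv w m - 2 * m * w m) / m ^ 4 = 0 := by
      rw [← hdz.deriv]
      exact hlocmax.deriv_eq_zero
    have hEm : m ^ 2 * deriv w m - 2 * m * w m = 0 := by
      rcases div_eq_zero_iff.mp hderiv0 with h | h
      · exact h
      · exact absurd h (pow_ne_zero 4 hm0.ne')
    exact key m hm0 hwm hEm.ge
  · -- Case B: `w > 0` on `(0, r₀]`
    push Not at hz
    have hposB : ∀ x, 0 < x → x ≤ r₀ → 0 < w x := by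
      intro x hx0 hxr
      rcases hxr.lt_or_eq with h | h
      · exact lt_of_le_of_ne (h0 x hx0) (Ne.symm (hz x hx0 h))
      · rw [h]; exact hw₀
    by_cases hE : ∃ x, 0 < x ∧ x ≤ r₀ ∧ 0 ≤ x ^ 2 * deriv w x - 2 * x * w x
    · obtain ⟨x, hx0, hxr, hEx⟩ := hE
      exact key x hx0 (hposB x hx0 hxr) hEx
    · push Not at hE
      set δ := -(r₀ ^ 2 * deriv w r₀ - 2 * r₀ * w r₀) with hδ
      have hδpos : 0 < δ := by
        have := hE r₀ hr₀ le_rfl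
        linarith
      -- `E ≤ -δ` on `(0, r₀]`
      have hEle : ∀ x, 0 < x → x ≤ r₀ → x ^ 2 * deriv w x - 2 * x * w x ≤ -δ := by
        intro x hx0 hxr
        have hmono := convexEndgame_monotoneOn_E (a := x) (b := r₀) hx0 h2
          (fun r hr => hposB r (hx0.trans_le hr.1) hr.2)
        have h' : x ^ 2 * deriv w x - 2 * x * w x ≤ r₀ ^ 2 * deriv w r₀ - 2 * r₀ * w r₀ :=
          hmono (left_mem_Icc.mpr hxr) (right_mem_Icc.mpr hxr) hxr
        linarith
      -- lower bound `z(x) ≥ δ/(3x³) + c₀` on `(0, r₀]`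
      set c₀ := w r₀ / r₀ ^ 2 - δ / (3 * r₀ ^ 3) with hc₀
      have hlow : ∀ x, 0 < x → x ≤ r₀ → δ / (3 * x ^ 3) + c₀ ≤ w x / x ^ 2 := by
        intro x hx0 hxr
        have hd : ∀ r ∈ Icc x r₀, HasDerivAt (fun y => w y / y ^ 2 - δ / (3 * y ^ 3))
            ((r ^ 2 * deriv w r - 2 * r * w r) / r ^ 4 - (-(δ / r ^ 4))) r := by
          intro r hr
          have hr0 : 0 < r := hx0.trans_le hr.1
          exact (convexEndgame_hasDerivAt_z hr0.ne'
            ((h2 r hr0 (hposB r hr0 hr.2)).1.differentiableAt (by norm_num))).sub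
            (convexEndgame_hasDerivAt_phi δ hr0.ne')
        have hanti : AntitoneOn (fun y => w y / y ^ 2 - δ / (3 * y ^ 3)) (Icc x r₀) := by
          apply antitoneOn_of_deriv_nonpos (convex_Icc x r₀)
          · exact fun r hr => (hd r hr).continuousAt.continuousWithinAt
          · exact fun r hr => (hd r (interior_subset hr)).differentiableAt.differentiableWithinAt
          · intro r hr
            have hr' : r ∈ Icc x r₀ := interior_subset hr
            have hr0 : 0 < r := hx0.trans_le hr'.1
            rw [(hd r hr').deriv]
            have hE' := hEle r hr0 hr'.2
            have hr4 : 0 < r ^ 4 := by positivity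
            have hrew : (r ^ 2 * deriv w r - 2 * r * w r) / r ^ 4 - (-(δ / r ^ 4))
                = (r ^ 2 * deriv w r - 2 * r * w r + δ) / r ^ 4 := by ring
            rw [hrew]
            exact div_nonpos_iff.mpr (Or.inr ⟨by linarith, hr4.le⟩)
        have hg : w r₀ / r₀ ^ 2 - δ / (3 * r₀ ^ 3) ≤ w x / x ^ 2 - δ / (3 * x ^ 3) :=
          hanti (left_mem_Icc.mpr hxr) (right_mem_Icc.mpr hxr) hxr
        linarith
      -- a small `x` violates `w ≤ C·x`
      have hK : 0 < C + |c₀| + 1 := by positivity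
      have hK0 : C + |c₀| + 1 ≠ 0 := hK.ne'
      set x := min (min r₀ 1) (δ / (3 * (C + |c₀| + 1))) with hxdef
      have hx0 : 0 < x := lt_min (lt_min hr₀ one_pos) (div_pos hδpos (by positivity))
      have hxne : x ≠ 0 := hx0.ne'
      have hxr : x ≤ r₀ := (min_le_left _ _).trans (min_le_left _ _)
      have hx1 : x ≤ 1 := (min_le_left _ _).trans (min_le_right _ _)
      have hxδ : x ≤ δ / (3 * (C + |c₀| + 1)) := min_le_right _ _
      have hl := hlow x hx0 hxr
      have hu := hC x hx0
      have hu' : w x / x ^ 2 ≤ C / x := by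
        rw [div_le_div_iff₀ (pow_pos hx0 2) hx0]
        nlinarith
      have h3 : δ / (3 * x ^ 3) ≤ C / x + |c₀| := by
        linarith [neg_le_abs c₀]
      have h4 : δ ≤ 3 * C * x ^ 2 + 3 * |c₀| * x ^ 3 := by
        rw [div_le_iff₀ (by positivity : (0 : ℝ) < 3 * x ^ 3)] at h3
        have e2 : (C / x + |c₀|) * (3 * x ^ 3) = 3 * C * x ^ 2 + 3 * |c₀| * x ^ 3 := by
          field_simp
        rw [e2] at h3
        exact h3
      have hx2le : x ^ 2 ≤ x := by nlinarith
      have hx3le : x ^ 3 ≤ x := by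
        have := mul_le_mul_of_nonneg_left hx2le hx0.le
        nlinarith
      have a1 := mul_le_mul_of_nonneg_left hx2le (by positivity : (0 : ℝ) ≤ 3 * C)
      have a2 := mul_le_mul_of_nonneg_left hx3le (by positivity : (0 : ℝ) ≤ 3 * |c₀|)
      have h5 : δ ≤ 3 * (C + |c₀|) * x := by linarith
      have h6 : 3 * (C + |c₀| + 1) * x ≤ δ := by
        have := mul_le_mul_of_nonneg_left hxδ (by positivity : (0 : ℝ) ≤ 3 * (C + |c₀| + 1))
        have e : 3 * (C + |c₀| + 1) * (δ / (3 * (C + |c₀| + 1))) = δ := by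
          field_simp
        linarith
      linarith

end Summit.NavierStokesRegularity.NavierStokesRegularity.Theorems.PoloidalLiouville.FluxStarvedDipole

end
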